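/-
Copyright (c) 2026 the pub-hodgecm-mathlib formalisation cell (harness21).  Prover seat hodgecm-mathlib-LH7-p07 (g2), Track B «K2-LIT» ∕ hLiu418, organ F4 (G-gen),
B3-b FILE 2d «THE COMPOSITION OF RECORD» (F4 desk K2Liu-p27 (g2) 2026-09-05T00:11:59Z (2)) (LEAD F0P6-plan (g14) BATCH #152 (1) ∕ #158; F4 lead K2Liu-p27 (g2)).  THEOREMS ONLY.
-/
import Summits.HodgeConjecture.HodgeConjecture.Theorems.K2LiuArchSWDataInductionOfRecord  -- ★ p863464 FILE 2c: `good_tupleVec` (five letters by value)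
import Summits.HodgeConjecture.HodgeConjecture.Theorems.K2LiuArchSWPivotOfRecord          -- ★ p863344 (K2Liu-p27): `swSection_junctionSlot_κOp_eq_vacScalar_mul` ((piv) modulo (R-grp)(R-det))
import Summits.HodgeConjecture.HodgeConjecture.Theorems.K2LiuFockKHInvariantsFFT          -- ★ (K2Liu-p23): `blockFFT`, `blockFFT_swap` (the block first fundamental theorems)
import Summits.HodgeConjecture.HodgeConjecture.Theorems.K2LiuArchSWDataDomainLetters       -- ★ (K2E3-p31) (ED. 2): `hdom_of_hermiteData`, `hHL_of_hermiteData` ((dom)(vac) from the Hermite data)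
import Summits.HodgeConjecture.HodgeConjecture.Theorems.K2LiuArchSWDataDerivLetters        -- ★ (K2Liu-p05) (ED. 3): `hDXp_of_onePlaceLetter`, `hDXm_of_onePlaceLetter` ((DX±) from the one-place letter `hψ`)
import HarnessLib

/-!
# Crux `HLiu418`, organ F4 (G-gen), B3-b FILE 2d: THE COMPOSITION OF RECORD — `Good` AT EVERY TUPLE VECTOR, LETTERS DISCHARGED BY NAME AS THEY LAND

Cell `hodgecm-mathlib`, crux item hLiu418 = `stmt-HodgeConjecture-24832` (helper lane `--kind proof --supports stmt-HodgeConjecture-24832 --as helper`,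
count-neutral; closes no socket); squad K2 ∕ K2Liu + F0∕P3c∕LH7; F4 lead ∕ desk K2Liu-p27 (g2) (hand named 2026-09-05T00:11:59Z (2): «(γ)+(δ) merged, one pen»);
boxes K2E5-r02 (g7), K2Liu-audit1; consumer K2E3-p23 (g8) ★ p863249 `K2LiuArchSWDataFinalPassage` (letter (gen) at `t := tupleVec`).  THEOREMS ONLY (no `def`, no
`instance`, no notation, no named-fact hypothesis, no `sorry`).

WHAT.  ★ FILE 2c `K2LiuArchSWDataInductionOfRecord.good_tupleVec` proves ★ FILE 3's letter (gen) from `hGgen`'s closure letters and FIVE letters BY VALUE: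
(piv) the see-saw pivot per real place, `hR hS` the block first fundamental theorems per place, (DX⁺)(DX⁻) the derivative letters, (dom) the degree ledger, (vac).
THIS FILE is the composition of record: each letter is replaced by its ★ supplier BY NAME as it lands (editions append-only).
* ED. 1 **`good_tupleVec_of_rightLegLetters`** — `hR hS` := ★ `K2LiuFockKHInvariantsFFT.blockFFT ∕ blockFFT_swap` (LETTER-FREE); (piv) := ★ p863344
  `swSection_junctionSlot_κOp_eq_vacScalar_mul` at `sB := doubledWeilRep χb` (★ `isDoubledWeilRep_doubledWeilRep`), `P = Q = Fin 2`, vacuum exponents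
  `⟨−|S_σ|, −|R_σ|, −|Fin 2|, −|Fin 2|⟩`, read through `genFamily` by ★ `swSectionTensor_apply` + ★ `stdExtension_smul` — so (piv) is reduced to the RIGHT-LEG LETTERS
  (R-grp) `kk hkk` ((iii) K2E3-p25, in flight) and (R-det) `xx hdet hxσ hx` (K2Liu-p26 📤 p863469) BY VALUE per place, in ★ p863344's bytes at `P = Q = Fin 2`,
  `R S := R σ, S σ`, `eP eQ := eP σ, eQ σ`; (DX±) ((D-let) K2Liu-p05), (dom)(vac) (K2E3-p31 `K2LiuArchSWDataDomainLetters`) and `χb`'s odd unitary arch type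
  `ht hodd` stay BY VALUE.
* ED. 2 **`good_tupleVec_of_hermiteData`** — also (dom) := ★ K2E3-p31 `K2LiuArchSWDataDomainLetters.hdom_of_hermiteData` and (vac) := ★ FILE 2b `vac_good_of_base` ∘ ★
  `hHL_of_hermiteData` at the hol cut of record, from ONE Hermite-data letter `hdat : ∀ D, IsArchDatum … (doubledWeilRep …) 𝒦 V_D` and `hGgen`'s (base) at `HLrecOfRecord`.
* ED. 3 **`good_tupleVec_of_onePlaceLetter`** — also (DX⁺)(DX⁻) := ★ K2Liu-p05 `K2LiuArchSWDataDerivLetters.hDXp_of_onePlaceLetter ∕ hDXm_of_onePlaceLetter` from the ONE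
  per-place letter `hψ` (section `ψ_σ` through the junction, curves, `detChar` derivatives), discharged at the frames of record by ★ `onePlaceLetter_of_junctionFrames`.
References: [Howe1989] §3; [KudlaRallis1994] §1, §3; [Weyl1939] Thm. 2.6.A; [KonnoKonno2007] Lemma 5.2; [Folland1989] Prop. (4.39) — citations; the file composes ★ files.
HONEST LABEL.  Count-neutral helper; `HC_CM` is proved only modulo the 7 printed citations (2 remaining named inputs: hLiu418 = `stmt-HodgeConjecture-24832`,
h413 = `stmt-HodgeConjecture-24833`) until rung 0 closes.
-/

set_option autoImplicit false
set_option linter.dupNamespace false -- the mandated namespace repeats `HodgeConjecture.HodgeConjecture`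

noncomputable section

open scoped Classical Matrix MatrixGroups TensorProduct Kronecker SchwartzMap Real
open MvPolynomial Complex
open NumberField NumberField.InfinitePlace NumberField.mixedEmbedding IsDedekindDomain
open Literature.Analysis.SegalBargmann Literature.RepresentationTheory.HeisenbergGroup
open Literature.NumberTheory.Automorphic Literature.NumberTheory.Automorphic.UnitaryGroup Literature.NumberTheory.GaloisRepresentations
open Literature.NumberTheory.Weil1964 Literature.NumberTheory.Weil1964.MpS Literature.NumberTheory.Weil1964.UnitaryWeil
open Literature.RepresentationTheory.HarrisKudlaSweet1996
open Literature.RepresentationTheory.KonnoKonno2007 Literature.RepresentationTheory.KonnoKonno2007.RealDualPair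
open Literature.RepresentationTheory.KonnoKonno2007.RealDualPair.UForm
open Literature.NumberTheory.GelbartRogawski1991 Literature.NumberTheory.GelbartRogawski1991.GRConstruction
open Literature.NumberTheory.GelbartRogawski1991.UnitaryDualPair
open Literature.NumberTheory.GelbartRogawski1991.UnitaryDualPair.LocalSplitting
open Literature.NumberTheory.K2Lit.SiegelDoubled
open Literature.NumberTheory.Automorphic.Liu2021
open Literature.NumberTheory.Automorphic.Liu2021.Def411WeilCarriers
open Literature.NumberTheory.Automorphic.Liu2021.Def411WeilCarriersDoubling
open Literature.RepresentationTheory.Liu2021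
open Summit.HodgeConjecture.HodgeConjecture.Cruxes.HLiu418.K2LiuArchSectionPlaceBlock
open Summit.HodgeConjecture.HodgeConjecture.Cruxes.HLiu418.K2LiuFaceGLetterDefs (IsArchStable genFamily HasArchDeriv)
open Summit.HodgeConjecture.HodgeConjecture.Cruxes.HLiu418.K2LiuArchSWDataTuplesDefs
open Summit.HodgeConjecture.HodgeConjecture.Cruxes.HLiu418.K2LiuArchSWDataInductionLift

open Summit.HodgeConjecture.HodgeConjecture.Cruxes.HLiu418.K2LiuPartnerEmbedding
open Summit.HodgeConjecture.HodgeConjecture.Cruxes.HLiu418.K2LiuArchSWDataInduction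
open Summit.HodgeConjecture.HodgeConjecture.Cruxes.HLiu418.K2LiuArchGaussianOfRecord (HLrecOfRecord)
open Summit.HodgeConjecture.HodgeConjecture.Cruxes.HLiu418.K2LiuArchSWSpanningDefs (IsArchDatum)

namespace Summit.HodgeConjecture.HodgeConjecture.Cruxes.HLiu418.K2LiuArchSWDataInductionFinal

variable (L : Type) [Field L] [NumberField L] [IsCMField L] {n : ℕ} (e : Fin 2 × Fin 1 ≃ Fin n)
  (dV : Fin 2 → L) (hdV : ∀ i, IsCMField.complexConj L (dV i) = dV i) (hdV0 : ∀ i, dV i ≠ 0)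
  (dW : Fin 1 → L) (hdW : ∀ i, IsCMField.complexConj L (dW i) = dW i) (hdW0 : ∀ i, dW i ≠ 0)
  {M' n' : ℕ} (eW : Fin 1 × Fin 3 ≃ Fin M') (e' : Fin 2 × Fin M' ≃ Fin n')
  (dV' : Fin 3 → L) (hdV' : ∀ k, IsCMField.complexConj L (dV' k) = dV' k) (hdV'0 : ∀ k, dV' k ≠ 0)
  (χb : HeckeCharacter L) (hχbu : χb.IsUnitary) (hχbs : Literature.RepresentationTheory.HarrisKudlaSweet1996.IsSplittingChar L 1 χb)
  (α : UnitaryGroup.adelicOne (Fp L) L (IsCMField.complexConj L) →* ℂˣ) (𝒦 : IwasawaDatum L e dV hdV dW hdW)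
  (R S : {v : InfinitePlace (Fp L) // v.IsReal} → Type) [∀ σ, Fintype (R σ)] [∀ σ, DecidableEq (R σ)] [∀ σ, Fintype (S σ)] [∀ σ, DecidableEq (S σ)]
  (eP : ∀ σ : {v : InfinitePlace (Fp L) // v.IsReal}, PosIdx (signVec (cmPlaceOver L) (fun k => Sum.elim (cmGramEntry L e' dV hdV (tensorFrame L dW eW dV') (tensorFrame_real L dW hdW eW dV' hdV')) (-cmGramEntry L e' dV hdV (tensorFrame L dW eW dV') (tensorFrame_real L dW hdW eW dV' hdV')) ((LocalSplitting.e₂ n').symm k)) (imagUnit L) σ) ≃ (Fin 2 × R σ) ⊕ (Fin 2 × S σ))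
  (eQ : ∀ σ : {v : InfinitePlace (Fp L) // v.IsReal}, NegIdx (signVec (cmPlaceOver L) (fun k => Sum.elim (cmGramEntry L e' dV hdV (tensorFrame L dW eW dV') (tensorFrame_real L dW hdW eW dV' hdV')) (-cmGramEntry L e' dV hdV (tensorFrame L dW eW dV') (tensorFrame_real L dW hdW eW dV' hdV')) ((LocalSplitting.e₂ n').symm k)) (imagUnit L) σ) ≃ (Fin 2 × S σ) ⊕ (Fin 2 × R σ))

/-! ## §1 The composition of record, ED. 1: `hR hS` by ★ block FFT, (piv) by ★ p863344 modulo (R-grp)(R-det) by value -/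

set_option maxHeartbeats 4000000 in -- the doubled-carrier telescope + J2c's frame chain (as ★ FILE 2c ∕ ★ p863344)
/-- **B3-b — `Good` AT EVERY TUPLE VECTOR OF THE BIG DATUM, COMPOSITION OF RECORD (ED. 1).**  ★ FILE 2c `good_tupleVec` with two of its five letters
DISCHARGED BY NAME: the block first fundamental theorems `hR hS` := ★ `K2LiuFockKHInvariantsFFT.blockFFT ∕ blockFFT_swap` (every `|R_σ|, |S_σ|`), and the see-saw
pivot (piv) := ★ p863344 `K2LiuArchSWPivotOfRecord.swSection_junctionSlot_κOp_eq_vacScalar_mul` at `sB := doubledWeilRep χb` (★ `isDoubledWeilRep_doubledWeilRep`),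
`P = Q = Fin 2` (`card (Fin 2) = n` from the model's `e`), vacuum exponents `⟨−|S_σ|, −|R_σ|, −2, −2⟩`, read through `genFamily = detChar · stdExtension 𝒦 s (swSectionTensor …)`
(★ `swSectionTensor_apply`, ★ `stdExtension_smul`) — MODULO the right-leg letters (R-grp) `kk hkk` ((iii), K2E3-p25) and (R-det) `xx hdet hxσ hx` (K2Liu-p26 📤 p863469)
BY VALUE per place, in ★ p863344's bytes.  Still BY VALUE: (DX⁺)(DX⁻) ((D-let), K2Liu-p05), (dom) and (vac) (K2E3-p31 `K2LiuArchSWDataDomainLetters`), and `χb`'s odd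
unitary arch type `ht hodd`.  Conclusion: ★ FILE 3's letter (gen) at `t := tupleVec`, bytes verbatim. [cite: Howe1989, §3] [cite: KudlaRallis1994, §1, §3]
[cite: Weyl1939, Thm. 2.6.A] [cite: KonnoKonno2007, Lemma 5.2 p. 73] [cite: Folland1989, §4.2 Prop. (4.39)] -/
theorem good_tupleVec_of_rightLegLetters
    (Good : (V : Submodule ℂ 𝓢(((Fin (n' + n')) → mixedSpace (Fp L)), ℂ)) → ↥(Submodule.span ℂ {x : piSchwartzBruhat (Fp L) (Fin (n' + n')) |
          ∃ a ∈ V, ∃ f : FinSB (Fp L) (Fin (n' + n')), x = piSchwartzBruhatEquiv (Fp L) (Fin (n' + n')) (a ⊗ₜ[ℂ] f)}) → Prop)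
    -- (congr) (zero) (add) (smul) (deriv): ★ `hGgen` bytes verbatim
    (hcongr : ∀ (V V' : Submodule ℂ 𝓢(((Fin (n' + n')) → mixedSpace (Fp L)), ℂ)) (x : ↥(Submodule.span ℂ {x : piSchwartzBruhat (Fp L) (Fin (n' + n')) |
          ∃ a ∈ V, ∃ f : FinSB (Fp L) (Fin (n' + n')), x = piSchwartzBruhatEquiv (Fp L) (Fin (n' + n')) (a ⊗ₜ[ℂ] f)})) (x' : ↥(Submodule.span ℂ {x : piSchwartzBruhat (Fp L) (Fin (n' + n')) |
          ∃ a ∈ V', ∃ f : FinSB (Fp L) (Fin (n' + n')), x = piSchwartzBruhatEquiv (Fp L) (Fin (n' + n')) (a ⊗ₜ[ℂ] f)})),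
      genFamily L e dV hdV hdV0 dW hdW hdW0 eW e' dV' hdV' hdV'0 χb hχbu hχbs α 𝒦 (x : piSchwartzBruhat (Fp L) (Fin (n' + n'))) =
        genFamily L e dV hdV hdV0 dW hdW hdW0 eW e' dV' hdV' hdV'0 χb hχbu hχbs α 𝒦 (x' : piSchwartzBruhat (Fp L) (Fin (n' + n'))) → Good V x → Good V' x')
    (hzero : ∀ (V : Submodule ℂ 𝓢(((Fin (n' + n')) → mixedSpace (Fp L)), ℂ)), FiniteDimensional ℂ V → IsArchStable L e dV hdV hdV0 dW hdW hdW0 eW e' dV' hdV' hdV'0 χb hχbu hχbs 𝒦 V → Good V 0)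
    (hadd : ∀ (V : Submodule ℂ 𝓢(((Fin (n' + n')) → mixedSpace (Fp L)), ℂ)), FiniteDimensional ℂ V → IsArchStable L e dV hdV hdV0 dW hdW hdW0 eW e' dV' hdV' hdV'0 χb hχbu hχbs 𝒦 V →
      ∀ x y : ↥(Submodule.span ℂ {x : piSchwartzBruhat (Fp L) (Fin (n' + n')) |
          ∃ a ∈ V, ∃ f : FinSB (Fp L) (Fin (n' + n')), x = piSchwartzBruhatEquiv (Fp L) (Fin (n' + n')) (a ⊗ₜ[ℂ] f)}), Good V x → Good V y → Good V (x + y))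
    (hsmul : ∀ (V : Submodule ℂ 𝓢(((Fin (n' + n')) → mixedSpace (Fp L)), ℂ)), FiniteDimensional ℂ V → IsArchStable L e dV hdV hdV0 dW hdW hdW0 eW e' dV' hdV' hdV'0 χb hχbu hχbs 𝒦 V →
      ∀ (c : ℂ) (x : ↥(Submodule.span ℂ {x : piSchwartzBruhat (Fp L) (Fin (n' + n')) |
          ∃ a ∈ V, ∃ f : FinSB (Fp L) (Fin (n' + n')), x = piSchwartzBruhatEquiv (Fp L) (Fin (n' + n')) (a ⊗ₜ[ℂ] f)})), Good V x → Good V (c • x))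
    (hderiv : ∀ (V : Submodule ℂ 𝓢(((Fin (n' + n')) → mixedSpace (Fp L)), ℂ)), FiniteDimensional ℂ V → IsArchStable L e dV hdV hdV0 dW hdW hdW0 eW e' dV' hdV' hdV'0 χb hχbu hχbs 𝒦 V →
          ∀ x : ↥(Submodule.span ℂ {x : piSchwartzBruhat (Fp L) (Fin (n' + n')) |
          ∃ a ∈ V, ∃ f : FinSB (Fp L) (Fin (n' + n')), x = piSchwartzBruhatEquiv (Fp L) (Fin (n' + n')) (a ⊗ₜ[ℂ] f)}), Good V x →
          ∀ (X : Matrix (Fin (n + n)) (Fin (n + n)) (mixedSpace L)) (hX : X ∈ archSkew (Fp L) L (IsCMField.complexConj L) (n + n) (hermD L e dV hdV dW hdW))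
            (V' : Submodule ℂ 𝓢(((Fin (n' + n')) → mixedSpace (Fp L)), ℂ)), FiniteDimensional ℂ V' → IsArchStable L e dV hdV hdV0 dW hdW hdW0 eW e' dV' hdV' hdV'0 χb hχbu hχbs 𝒦 V' →
          ∀ x' : ↥(Submodule.span ℂ {x : piSchwartzBruhat (Fp L) (Fin (n' + n')) |
          ∃ a ∈ V', ∃ f : FinSB (Fp L) (Fin (n' + n')), x = piSchwartzBruhatEquiv (Fp L) (Fin (n' + n')) (a ⊗ₜ[ℂ] f)}),
          HasArchDeriv L e dV hdV dW hdW hX (fun h => genFamily L e dV hdV hdV0 dW hdW hdW0 eW e' dV' hdV' hdV'0 χb hχbu hχbs α 𝒦 (x : piSchwartzBruhat (Fp L) (Fin (n' + n'))) ((((3 : ℕ) : ℂ) - (n : ℂ)) / 2) h)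
            (fun h => genFamily L e dV hdV hdV0 dW hdW hdW0 eW e' dV' hdV' hdV'0 χb hχbu hχbs α 𝒦 (x' : piSchwartzBruhat (Fp L) (Fin (n' + n'))) ((((3 : ℕ) : ℂ) - (n : ℂ)) / 2) h) → Good V' x')
    -- (dom) the degree ledger BY VALUE: every finite set of tuple vectors lies in some finite-dimensional arch-stable space (★ FILE 3's letter bytes at `t := tupleVec`)
    (hdom : ∀ s : Finset ((σ : {v : InfinitePlace (Fp L) // v.IsReal}) → MvPolynomial (DPIdx (Fin 2) (Fin 2) (R σ) (S σ)) ℂ), ∃ V' : Submodule ℂ 𝓢(((Fin (n' + n')) → mixedSpace (Fp L)), ℂ),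
      FiniteDimensional ℂ V' ∧ IsArchStable L e dV hdV hdV0 dW hdW hdW0 eW e' dV' hdV' hdV'0 χb hχbu hχbs 𝒦 V' ∧ ∀ β ∈ s, tupleVec L dV hdV hdV0 dW hdW hdW0 eW e' dV' hdV' hdV'0 R S eP eQ β ∈ V')
    -- the arch type of `χb` (odd unitary type `(t, 0)`, as ★ (P-arch) ∕ ★ p863344)
    {t : InfinitePlace L → ℤ} (ht : χb.HasUnitaryArchType t 0) (hodd : ∀ w, Odd (t w))
    -- (R-grp) + (R-det) BY VALUE per real place (★ p863344's binders `kk hkk xx hdet hxσ hx` at `P = Q = Fin 2`, `R S := R σ, S σ`): (R-grp)(iii) K2E3-p25, (R-det) K2Liu-p26 📤 p863469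
    (kk : ∀ σ : {v : InfinitePlace (Fp L) // v.IsReal}, Matrix.unitaryGroup (R σ) ℂ × Matrix.unitaryGroup (S σ) ℂ → UnitaryGroup.adelic (Fp L) L (IsCMField.complexConj L) 3 (Matrix.diagonal dV'))
    (hkk : ∀ (σ : {v : InfinitePlace (Fp L) // v.IsReal}) (k : Matrix.unitaryGroup (R σ) ℂ × Matrix.unitaryGroup (S σ) ℂ),
      partnerEmb L e dV hdV dW hdW eW e' dV' hdV' (kk σ k) =
        K2LiuArchOneParameterOrbitDefs.archEmb (Fp L) L (IsCMField.complexConj L) (n' + n')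
              (hermD L e' dV hdV (tensorFrame L dW eW dV') (tensorFrame_real L dW hdW eW dV' hdV'))
              (placeSecJ L (IsCMField.complexConj L) (n' + n') (IsCMField.complexConj_ne_one L) (cmPlaceOver L) (cmPlaceOver_smul L) _
                (gramD_gram_realDiagonal_entry_ne_zero L e' dV hdV (tensorFrame L dW eW dV') (tensorFrame_real L dW hdW eW dV' hdV') hdV0 (tensorFrame_ne_zero L dW eW dV' hdW0 hdV'0)) (complexConj_imagUnit L) (imagUnit_ne_zero L) σ
                (cmPlaceOver_comap L) (gramD_eq_diagonal_cm L e' dV hdV (tensorFrame L dW eW dV') (tensorFrame_real L dW hdW eW dV' hdV')) (J := hermD L e' dV hdV (tensorFrame L dW eW dV') (tensorFrame_real L dW hdW eW dV' hdV')) rfl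
                (complexConj_smul_infinitePlace L) (eP σ) (eQ σ) ((toBig (Fin 2) (Fin 2) (R σ) (S σ) (κ (Fin 2) (Fin 2) (R σ) (S σ) ((1 : Matrix.unitaryGroup (Fin 2) ℂ × Matrix.unitaryGroup (Fin 2) ℂ), k)), (1 : UForm Unit Empty)) : Ginf ((Fin 2 × R σ) ⊕ (Fin 2 × S σ)) ((Fin 2 × S σ) ⊕ (Fin 2 × R σ)) Unit Empty)))
    (xx : ∀ σ : {v : InfinitePlace (Fp L) // v.IsReal}, Matrix.unitaryGroup (R σ) ℂ × Matrix.unitaryGroup (S σ) ℂ → (InfiniteAdeleRing L)ˣ)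
    (hdet : ∀ (σ : {v : InfinitePlace (Fp L) // v.IsReal}) (k : Matrix.unitaryGroup (R σ) ℂ × Matrix.unitaryGroup (S σ) ℂ),
      Matrix.GeneralLinearGroup.det ((kk σ k : UnitaryGroup.adelic (Fp L) L (IsCMField.complexConj L) 3 (Matrix.diagonal dV')) :
        GL (Fin 3) (AdeleRing (𝓞 L) L)) = infiniteIdeles L (xx σ k))
    (hxσ : ∀ (σ : {v : InfinitePlace (Fp L) // v.IsReal}) (k : Matrix.unitaryGroup (R σ) ℂ × Matrix.unitaryGroup (S σ) ℂ),
      InfinitePlace.Completion.extensionEmbedding (cmPlaceOver L σ).1 ((xx σ k : InfiniteAdeleRing L) (cmPlaceOver L σ).1) =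
        (k.1 : Matrix (R σ) (R σ) ℂ).det * (k.2 : Matrix (S σ) (S σ) ℂ).det)
    (hx : ∀ (σ : {v : InfinitePlace (Fp L) // v.IsReal}) (k : Matrix.unitaryGroup (R σ) ℂ × Matrix.unitaryGroup (S σ) ℂ) (w : InfinitePlace L), w ≠ (cmPlaceOver L σ).1 →
      InfinitePlace.Completion.extensionEmbedding w ((xx σ k : InfiniteAdeleRing L) w) = 1)
    -- (DX⁺) (DX⁻) the two derivative letters per place BY VALUE (`Good`-free): the boost `hypOpGen_{pq}` (resp. its `μ₀(D_{π∕2})`-conjugate) of the `σ`-slot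
    -- is the arch Lie derivative of the twisted generator family along some `X ∈ 𝔲` (★ W4 + ★ F2 + ★ (T2-an) + ★ FILE 1; payer named by LEAD)
    (hDXp : ∀ (σ : {v : InfinitePlace (Fp L) // v.IsReal}) (rest : ((τ : {v : InfinitePlace (Fp L) // v.IsReal}) → MvPolynomial (DPIdx (Fin 2) (Fin 2) (R τ) (S τ)) ℂ)) (i : Fin 2 × Fin 2) (F : MvPolynomial (DPIdx (Fin 2) (Fin 2) (R σ) (S σ)) ℂ) (f : FinSB (Fp L) (Fin (n' + n'))),
      ∃ (X : Matrix (Fin (n + n)) (Fin (n + n)) (mixedSpace L)) (hX : X ∈ archSkew (Fp L) L (IsCMField.complexConj L) (n + n) (hermD L e dV hdV dW hdW))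
        (c : ℂ) (G : MvPolynomial (DPIdx (Fin 2) (Fin 2) (R σ) (S σ)) ℂ), binvPi G = hypOpGenC (R σ) (S σ) i.1 i.2 (binvPi F) ∧
        HasArchDeriv L e dV hdV dW hdW hX (fun h => genFamily L e dV hdV hdV0 dW hdW hdW0 eW e' dV' hdV' hdV'0 χb hχbu hχbs α 𝒦 (piSchwartzBruhatEquiv (Fp L) (Fin (n' + n')) (tupleVec L dV hdV hdV0 dW hdW hdW0 eW e' dV' hdV' hdV'0 R S eP eQ (Function.update rest σ F) ⊗ₜ[ℂ] f)) ((((3 : ℕ) : ℂ) - (n : ℂ)) / 2) h)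
          (fun h => genFamily L e dV hdV hdV0 dW hdW hdW0 eW e' dV' hdV' hdV'0 χb hχbu hχbs α 𝒦 (piSchwartzBruhatEquiv (Fp L) (Fin (n' + n')) (tupleVec L dV hdV hdV0 dW hdW hdW0 eW e' dV' hdV' hdV'0 R S eP eQ (Function.update rest σ (c • F + G)) ⊗ₜ[ℂ] f)) ((((3 : ℕ) : ℂ) - (n : ℂ)) / 2) h))
    (hDXm : ∀ (σ : {v : InfinitePlace (Fp L) // v.IsReal}) (rest : ((τ : {v : InfinitePlace (Fp L) // v.IsReal}) → MvPolynomial (DPIdx (Fin 2) (Fin 2) (R τ) (S τ)) ℂ)) (i : Fin 2 × Fin 2) (F : MvPolynomial (DPIdx (Fin 2) (Fin 2) (R σ) (S σ)) ℂ) (f : FinSB (Fp L) (Fin (n' + n'))),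
      ∃ (X : Matrix (Fin (n + n)) (Fin (n + n)) (mixedSpace L)) (hX : X ∈ archSkew (Fp L) L (IsCMField.complexConj L) (n + n) (hermD L e dV hdV dW hdW))
        (c : ℂ) (G : MvPolynomial (DPIdx (Fin 2) (Fin 2) (R σ) (S σ)) ℂ),
        binvPi G = unitaryOpPi (phaseU (R σ) (S σ) i.1 (π / 2)) (hypOpGenC (R σ) (S σ) i.1 i.2 (unitaryOpPi (phaseU (R σ) (S σ) i.1 (π / 2))⁻¹ (binvPi F))) ∧
        HasArchDeriv L e dV hdV dW hdW hX (fun h => genFamily L e dV hdV hdV0 dW hdW hdW0 eW e' dV' hdV' hdV'0 χb hχbu hχbs α 𝒦 (piSchwartzBruhatEquiv (Fp L) (Fin (n' + n')) (tupleVec L dV hdV hdV0 dW hdW hdW0 eW e' dV' hdV' hdV'0 R S eP eQ (Function.update rest σ F) ⊗ₜ[ℂ] f)) ((((3 : ℕ) : ℂ) - (n : ℂ)) / 2) h)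
          (fun h => genFamily L e dV hdV hdV0 dW hdW hdW0 eW e' dV' hdV' hdV'0 χb hχbu hχbs α 𝒦 (piSchwartzBruhatEquiv (Fp L) (Fin (n' + n')) (tupleVec L dV hdV hdV0 dW hdW hdW0 eW e' dV' hdV' hdV'0 R S eP eQ (Function.update rest σ (c • F + G)) ⊗ₜ[ℂ] f)) ((((3 : ℕ) : ℂ) - (n : ℂ)) / 2) h))
    -- (vac) `Good` at the all-vacuum tuple (`tupleVec 1` = ★ `archGaussianOfRecord`) in every admissible domain containing it — (base) + (congr), cf. `vac_good_of_base`
    (hvac : ∀ f : FinSB (Fp L) (Fin (n' + n')), (∀ V' : Submodule ℂ 𝓢(((Fin (n' + n')) → mixedSpace (Fp L)), ℂ), FiniteDimensional ℂ V' →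
      IsArchStable L e dV hdV hdV0 dW hdW hdW0 eW e' dV' hdV' hdV'0 χb hχbu hχbs 𝒦 V' →
      ∀ hx : piSchwartzBruhatEquiv (Fp L) (Fin (n' + n')) (tupleVec L dV hdV hdV0 dW hdW hdW0 eW e' dV' hdV' hdV'0 R S eP eQ (fun _ => 1) ⊗ₜ[ℂ] f) ∈ Submodule.span ℂ {x : piSchwartzBruhat (Fp L) (Fin (n' + n')) |
          ∃ a ∈ V', ∃ f : FinSB (Fp L) (Fin (n' + n')), x = piSchwartzBruhatEquiv (Fp L) (Fin (n' + n')) (a ⊗ₜ[ℂ] f)},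
        Good V' ⟨piSchwartzBruhatEquiv (Fp L) (Fin (n' + n')) (tupleVec L dV hdV hdV0 dW hdW hdW0 eW e' dV' hdV' hdV'0 R S eP eQ (fun _ => 1) ⊗ₜ[ℂ] f), hx⟩)) :
    ∀ (a : ((σ : {v : InfinitePlace (Fp L) // v.IsReal}) → MvPolynomial (DPIdx (Fin 2) (Fin 2) (R σ) (S σ)) ℂ)) (f : FinSB (Fp L) (Fin (n' + n'))) (V' : Submodule ℂ 𝓢(((Fin (n' + n')) → mixedSpace (Fp L)), ℂ)), FiniteDimensional ℂ V' →
      IsArchStable L e dV hdV hdV0 dW hdW hdW0 eW e' dV' hdV' hdV'0 χb hχbu hχbs 𝒦 V' →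
      ∀ hx : piSchwartzBruhatEquiv (Fp L) (Fin (n' + n')) (tupleVec L dV hdV hdV0 dW hdW hdW0 eW e' dV' hdV' hdV'0 R S eP eQ a ⊗ₜ[ℂ] f) ∈ Submodule.span ℂ {x : piSchwartzBruhat (Fp L) (Fin (n' + n')) |
          ∃ a ∈ V', ∃ f : FinSB (Fp L) (Fin (n' + n')), x = piSchwartzBruhatEquiv (Fp L) (Fin (n' + n')) (a ⊗ₜ[ℂ] f)},
        Good V' ⟨piSchwartzBruhatEquiv (Fp L) (Fin (n' + n')) (tupleVec L dV hdV hdV0 dW hdW hdW0 eW e' dV' hdV' hdV'0 R S eP eQ a ⊗ₜ[ℂ] f), hx⟩ := by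
  -- `|P| = |Q| = n` at `P = Q = Fin 2` from the model's `e : Fin 2 × Fin 1 ≃ Fin n`
  have hn : Fintype.card (Fin 2) = n := by
    have h := Fintype.card_congr e
    simp only [Fintype.card_prod, Fintype.card_fin, mul_one] at h
    rw [Fintype.card_fin]
    exact h
  refine K2LiuArchSWDataInductionOfRecord.good_tupleVec L e dV hdV hdV0 dW hdW hdW0 eW e' dV' hdV' hdV'0 χb hχbu hχbs α 𝒦 R S eP eQ
    (fun σ => (⟨-(Fintype.card (S σ) : ℤ), -(Fintype.card (R σ) : ℤ), -(Fintype.card (Fin 2) : ℤ), -(Fintype.card (Fin 2) : ℤ)⟩ : VacExponents)) Good hcongr hzero hadd hsmul hderiv hdom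
    (fun σ k v w f a a' ha ha' => ?_) (fun σ PR hPR => K2LiuFockKHInvariantsFFT.blockFFT PR hPR) (fun σ PS hPS => K2LiuFockKHInvariantsFFT.blockFFT_swap PS hPS)
    hDXp hDXm hvac
  -- (piv): ★ p863344 at `sB := doubledWeilRep χb`, every `h ∈ U(𝔻)(𝔸)`, read through `genFamily`
  have key : ∀ h : HA L e dV hdV dW hdW,
      swSectionTensor L e dV hdV dW hdW eW e' dV' hdV' hdV0 hdW0 hdV'0
          (doubledWeilRep L e' dV hdV hdV0 (tensorFrame L dW eW dV') (tensorFrame_real L dW hdW eW dV' hdV') (tensorFrame_ne_zero L dW eW dV' hdW0 hdV'0) χb hχbu hχbs)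
          (piSchwartzBruhatEquiv (Fp L) (Fin (n' + n')) (a' ⊗ₜ[ℂ] f)) h =
        vacScalar (⟨-(Fintype.card (S σ) : ℤ), -(Fintype.card (R σ) : ℤ), -(Fintype.card (Fin 2) : ℤ), -(Fintype.card (Fin 2) : ℤ)⟩ : VacExponents) ((1, k) : DPK (Fin 2) (Fin 2) (R σ) (S σ)) *
          swSectionTensor L e dV hdV dW hdW eW e' dV' hdV' hdV0 hdW0 hdV'0
            (doubledWeilRep L e' dV hdV hdV0 (tensorFrame L dW eW dV') (tensorFrame_real L dW hdW eW dV' hdV') (tensorFrame_ne_zero L dW eW dV' hdW0 hdV'0) χb hχbu hχbs)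
            (piSchwartzBruhatEquiv (Fp L) (Fin (n' + n')) (a ⊗ₜ[ℂ] f)) h := fun h => by
    rw [swSectionTensor_apply, swSectionTensor_apply]
    exact K2LiuArchSWPivotOfRecord.swSection_junctionSlot_κOp_eq_vacScalar_mul L e dV hdV hdV0 dW hdW hdW0 eW e' dV' hdV' hdV'0 σ (eP σ) (eQ σ) hχbu hχbs
      (isDoubledWeilRep_doubledWeilRep L e' dV hdV hdV0 (tensorFrame L dW eW dV') (tensorFrame_real L dW hdW eW dV' hdV') (tensorFrame_ne_zero L dW eW dV' hdW0 hdV'0) χb hχbu hχbs)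
      ht hodd hn hn (kk σ) (hkk σ) (xx σ) (hdet σ) (hxσ σ) (hx σ) f h k v w a a' ha ha'
  have hT : swSectionTensor L e dV hdV dW hdW eW e' dV' hdV' hdV0 hdW0 hdV'0
          (doubledWeilRep L e' dV hdV hdV0 (tensorFrame L dW eW dV') (tensorFrame_real L dW hdW eW dV' hdV') (tensorFrame_ne_zero L dW eW dV' hdW0 hdV'0) χb hχbu hχbs)
          (piSchwartzBruhatEquiv (Fp L) (Fin (n' + n')) (a' ⊗ₜ[ℂ] f)) =
        vacScalar (⟨-(Fintype.card (S σ) : ℤ), -(Fintype.card (R σ) : ℤ), -(Fintype.card (Fin 2) : ℤ), -(Fintype.card (Fin 2) : ℤ)⟩ : VacExponents) ((1, k) : DPK (Fin 2) (Fin 2) (R σ) (S σ)) •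
          swSectionTensor L e dV hdV dW hdW eW e' dV' hdV' hdV0 hdW0 hdV'0
            (doubledWeilRep L e' dV hdV hdV0 (tensorFrame L dW eW dV') (tensorFrame_real L dW hdW eW dV' hdV') (tensorFrame_ne_zero L dW eW dV' hdW0 hdV'0) χb hχbu hχbs)
            (piSchwartzBruhatEquiv (Fp L) (Fin (n' + n')) (a ⊗ₜ[ℂ] f)) := by
    funext h
    rw [Pi.smul_apply, smul_eq_mul]
    exact key h
  funext s h
  simp only [K2LiuFaceGLetterDefs.genFamily, Pi.smul_apply, smul_eq_mul]
  rw [hT, stdExtension_smul, Pi.smul_apply, Pi.smul_apply, smul_eq_mul]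
  ring


/-! ## §2 The composition of record, ED. 2: (dom) and (vac) by ★ `K2LiuArchSWDataDomainLetters` (K2E3-p31) from the Hermite data `hdat` and (base) at the hol cut of record -/

set_option maxHeartbeats 4000000 in -- as ED. 1
/-- **B3-b — COMPOSITION OF RECORD, ED. 2.**  ED. 1 `good_tupleVec_of_rightLegLetters` with two more letters discharged BY NAME: (dom) := ★ K2E3-p31
`K2LiuArchSWDataDomainLetters.hdom_of_hermiteData` and (vac) := ★ FILE 2b `vac_good_of_base` at `HL₀ := HLrecOfRecord …` fed by ★ `hHL_of_hermiteData` — both from the ONE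
Hermite-data letter `hdat : ∀ D, IsArchDatum … (doubledWeilRep …) 𝒦 V_D` (★ σ15 `isArchDatum_hermiteSpan` modulo the closure letter `hK` of the Iwasawa datum of record, an
organ-level input at the tie) and `hGgen`'s (base) at the hol cut of record.  Residual letters BY VALUE: (R-grp) `kk hkk` + (R-det) `xx hdet hxσ hx` per place ((iii) K2E3-p25;
★ p863469 K2Liu-p26 supplies the det letters for `kk := adelicSingle σ (toUFormEquiv⁻¹ (kV k))`), (DX⁺)(DX⁻) ((D-let) K2Liu-p05), `hdat`, `hbase`, `ht hodd`.  Conclusion: ★ FILE 3's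
letter (gen) at `t := tupleVec`, bytes verbatim. [cite: Howe1989, §3] [cite: KudlaRallis1994, §1, §3] [cite: Folland1989, §1.7 (1.81), §4.2 Prop. (4.39)]
[cite: Liu2021, App. B proof of Prop. B.8 pp. 103–106] -/
theorem good_tupleVec_of_hermiteData
    (Good : (V : Submodule ℂ 𝓢(((Fin (n' + n')) → mixedSpace (Fp L)), ℂ)) → ↥(Submodule.span ℂ {x : piSchwartzBruhat (Fp L) (Fin (n' + n')) |
          ∃ a ∈ V, ∃ f : FinSB (Fp L) (Fin (n' + n')), x = piSchwartzBruhatEquiv (Fp L) (Fin (n' + n')) (a ⊗ₜ[ℂ] f)}) → Prop)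
    -- (congr) (zero) (add) (smul) (deriv): ★ `hGgen` bytes verbatim
    (hcongr : ∀ (V V' : Submodule ℂ 𝓢(((Fin (n' + n')) → mixedSpace (Fp L)), ℂ)) (x : ↥(Submodule.span ℂ {x : piSchwartzBruhat (Fp L) (Fin (n' + n')) |
          ∃ a ∈ V, ∃ f : FinSB (Fp L) (Fin (n' + n')), x = piSchwartzBruhatEquiv (Fp L) (Fin (n' + n')) (a ⊗ₜ[ℂ] f)})) (x' : ↥(Submodule.span ℂ {x : piSchwartzBruhat (Fp L) (Fin (n' + n')) |
          ∃ a ∈ V', ∃ f : FinSB (Fp L) (Fin (n' + n')), x = piSchwartzBruhatEquiv (Fp L) (Fin (n' + n')) (a ⊗ₜ[ℂ] f)})),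
      genFamily L e dV hdV hdV0 dW hdW hdW0 eW e' dV' hdV' hdV'0 χb hχbu hχbs α 𝒦 (x : piSchwartzBruhat (Fp L) (Fin (n' + n'))) =
        genFamily L e dV hdV hdV0 dW hdW hdW0 eW e' dV' hdV' hdV'0 χb hχbu hχbs α 𝒦 (x' : piSchwartzBruhat (Fp L) (Fin (n' + n'))) → Good V x → Good V' x')
    (hzero : ∀ (V : Submodule ℂ 𝓢(((Fin (n' + n')) → mixedSpace (Fp L)), ℂ)), FiniteDimensional ℂ V → IsArchStable L e dV hdV hdV0 dW hdW hdW0 eW e' dV' hdV' hdV'0 χb hχbu hχbs 𝒦 V → Good V 0)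
    (hadd : ∀ (V : Submodule ℂ 𝓢(((Fin (n' + n')) → mixedSpace (Fp L)), ℂ)), FiniteDimensional ℂ V → IsArchStable L e dV hdV hdV0 dW hdW hdW0 eW e' dV' hdV' hdV'0 χb hχbu hχbs 𝒦 V →
      ∀ x y : ↥(Submodule.span ℂ {x : piSchwartzBruhat (Fp L) (Fin (n' + n')) |
          ∃ a ∈ V, ∃ f : FinSB (Fp L) (Fin (n' + n')), x = piSchwartzBruhatEquiv (Fp L) (Fin (n' + n')) (a ⊗ₜ[ℂ] f)}), Good V x → Good V y → Good V (x + y))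
    (hsmul : ∀ (V : Submodule ℂ 𝓢(((Fin (n' + n')) → mixedSpace (Fp L)), ℂ)), FiniteDimensional ℂ V → IsArchStable L e dV hdV hdV0 dW hdW hdW0 eW e' dV' hdV' hdV'0 χb hχbu hχbs 𝒦 V →
      ∀ (c : ℂ) (x : ↥(Submodule.span ℂ {x : piSchwartzBruhat (Fp L) (Fin (n' + n')) |
          ∃ a ∈ V, ∃ f : FinSB (Fp L) (Fin (n' + n')), x = piSchwartzBruhatEquiv (Fp L) (Fin (n' + n')) (a ⊗ₜ[ℂ] f)})), Good V x → Good V (c • x))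
    (hderiv : ∀ (V : Submodule ℂ 𝓢(((Fin (n' + n')) → mixedSpace (Fp L)), ℂ)), FiniteDimensional ℂ V → IsArchStable L e dV hdV hdV0 dW hdW hdW0 eW e' dV' hdV' hdV'0 χb hχbu hχbs 𝒦 V →
          ∀ x : ↥(Submodule.span ℂ {x : piSchwartzBruhat (Fp L) (Fin (n' + n')) |
          ∃ a ∈ V, ∃ f : FinSB (Fp L) (Fin (n' + n')), x = piSchwartzBruhatEquiv (Fp L) (Fin (n' + n')) (a ⊗ₜ[ℂ] f)}), Good V x →
          ∀ (X : Matrix (Fin (n + n)) (Fin (n + n)) (mixedSpace L)) (hX : X ∈ archSkew (Fp L) L (IsCMField.complexConj L) (n + n) (hermD L e dV hdV dW hdW))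
            (V' : Submodule ℂ 𝓢(((Fin (n' + n')) → mixedSpace (Fp L)), ℂ)), FiniteDimensional ℂ V' → IsArchStable L e dV hdV hdV0 dW hdW hdW0 eW e' dV' hdV' hdV'0 χb hχbu hχbs 𝒦 V' →
          ∀ x' : ↥(Submodule.span ℂ {x : piSchwartzBruhat (Fp L) (Fin (n' + n')) |
          ∃ a ∈ V', ∃ f : FinSB (Fp L) (Fin (n' + n')), x = piSchwartzBruhatEquiv (Fp L) (Fin (n' + n')) (a ⊗ₜ[ℂ] f)}),
          HasArchDeriv L e dV hdV dW hdW hX (fun h => genFamily L e dV hdV hdV0 dW hdW hdW0 eW e' dV' hdV' hdV'0 χb hχbu hχbs α 𝒦 (x : piSchwartzBruhat (Fp L) (Fin (n' + n'))) ((((3 : ℕ) : ℂ) - (n : ℂ)) / 2) h)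
            (fun h => genFamily L e dV hdV hdV0 dW hdW hdW0 eW e' dV' hdV' hdV'0 χb hχbu hχbs α 𝒦 (x' : piSchwartzBruhat (Fp L) (Fin (n' + n'))) ((((3 : ℕ) : ℂ) - (n : ℂ)) / 2) h) → Good V' x')
    -- (base) of ★ `hGgen` at the hol cut of record `HL₀ := HLrecOfRecord …` (★ LH7-p05; `= holCutOfRecord …`, «`V₀ = ℂ ∙ v_G`»), bytes of ★ `faceG_of_organs` :194–196
    (hbase : ∀ (V₀ : Submodule ℂ 𝓢(((Fin (n' + n')) → mixedSpace (Fp L)), ℂ)), FiniteDimensional ℂ V₀ → IsArchStable L e dV hdV hdV0 dW hdW hdW0 eW e' dV' hdV' hdV'0 χb hχbu hχbs 𝒦 V₀ →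
      HLrecOfRecord L dV hdV hdV0 dW hdW hdW0 eW e' dV' hdV' hdV'0 V₀ → ∀ x₀ : ↥(Submodule.span ℂ {x : piSchwartzBruhat (Fp L) (Fin (n' + n')) |
          ∃ a ∈ V₀, ∃ f : FinSB (Fp L) (Fin (n' + n')), x = piSchwartzBruhatEquiv (Fp L) (Fin (n' + n')) (a ⊗ₜ[ℂ] f)}), Good V₀ x₀)
    -- (dat) the Hermite data BY VALUE: every Hermite span `V_D` of the doubled frame is an arch datum for `𝒦` (★ σ15 `isArchDatum_hermiteSpan … 𝒦 hK D`; K2E3-p31's ★ bytes)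
    (hdat : ∀ D : ℕ, IsArchDatum L e dV hdV dW hdW eW e' dV' hdV'
      (doubledWeilRep L e' dV hdV hdV0 (tensorFrame L dW eW dV') (tensorFrame_real L dW hdW eW dV' hdV') (tensorFrame_ne_zero L dW eW dV' hdW0 hdV'0) χb hχbu hχbs) 𝒦
      (Submodule.span ℂ {x : 𝓢((Fin (n' + n') → mixedSpace (Fp L)), ℂ) | ∃ γ : (Fin (n' + n') × {v : InfinitePlace (Fp L) // v.IsReal}) →₀ ℕ, γ.degree ≤ D ∧
        follandHermite (GRConstruction.frameD L e' dV hdV hdV0 (tensorFrame L dW eW dV') (tensorFrame_real L dW hdW eW dV' hdV') (tensorFrame_ne_zero L dW eW dV' hdW0 hdV'0)) γ = x}))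
    -- the arch type of `χb` (odd unitary type `(t, 0)`, as ★ (P-arch) ∕ ★ p863344)
    {t : InfinitePlace L → ℤ} (ht : χb.HasUnitaryArchType t 0) (hodd : ∀ w, Odd (t w))
    -- (R-grp) + (R-det) BY VALUE per real place (★ p863344's binders `kk hkk xx hdet hxσ hx` at `P = Q = Fin 2`, `R S := R σ, S σ`): (R-grp)(iii) K2E3-p25, (R-det) K2Liu-p26 📤 p863469
    (kk : ∀ σ : {v : InfinitePlace (Fp L) // v.IsReal}, Matrix.unitaryGroup (R σ) ℂ × Matrix.unitaryGroup (S σ) ℂ → UnitaryGroup.adelic (Fp L) L (IsCMField.complexConj L) 3 (Matrix.diagonal dV'))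
    (hkk : ∀ (σ : {v : InfinitePlace (Fp L) // v.IsReal}) (k : Matrix.unitaryGroup (R σ) ℂ × Matrix.unitaryGroup (S σ) ℂ),
      partnerEmb L e dV hdV dW hdW eW e' dV' hdV' (kk σ k) =
        K2LiuArchOneParameterOrbitDefs.archEmb (Fp L) L (IsCMField.complexConj L) (n' + n')
              (hermD L e' dV hdV (tensorFrame L dW eW dV') (tensorFrame_real L dW hdW eW dV' hdV'))
              (placeSecJ L (IsCMField.complexConj L) (n' + n') (IsCMField.complexConj_ne_one L) (cmPlaceOver L) (cmPlaceOver_smul L) _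
                (gramD_gram_realDiagonal_entry_ne_zero L e' dV hdV (tensorFrame L dW eW dV') (tensorFrame_real L dW hdW eW dV' hdV') hdV0 (tensorFrame_ne_zero L dW eW dV' hdW0 hdV'0)) (complexConj_imagUnit L) (imagUnit_ne_zero L) σ
                (cmPlaceOver_comap L) (gramD_eq_diagonal_cm L e' dV hdV (tensorFrame L dW eW dV') (tensorFrame_real L dW hdW eW dV' hdV')) (J := hermD L e' dV hdV (tensorFrame L dW eW dV') (tensorFrame_real L dW hdW eW dV' hdV')) rfl
                (complexConj_smul_infinitePlace L) (eP σ) (eQ σ) ((toBig (Fin 2) (Fin 2) (R σ) (S σ) (κ (Fin 2) (Fin 2) (R σ) (S σ) ((1 : Matrix.unitaryGroup (Fin 2) ℂ × Matrix.unitaryGroup (Fin 2) ℂ), k)), (1 : UForm Unit Empty)) : Ginf ((Fin 2 × R σ) ⊕ (Fin 2 × S σ)) ((Fin 2 × S σ) ⊕ (Fin 2 × R σ)) Unit Empty)))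
    (xx : ∀ σ : {v : InfinitePlace (Fp L) // v.IsReal}, Matrix.unitaryGroup (R σ) ℂ × Matrix.unitaryGroup (S σ) ℂ → (InfiniteAdeleRing L)ˣ)
    (hdet : ∀ (σ : {v : InfinitePlace (Fp L) // v.IsReal}) (k : Matrix.unitaryGroup (R σ) ℂ × Matrix.unitaryGroup (S σ) ℂ),
      Matrix.GeneralLinearGroup.det ((kk σ k : UnitaryGroup.adelic (Fp L) L (IsCMField.complexConj L) 3 (Matrix.diagonal dV')) :
        GL (Fin 3) (AdeleRing (𝓞 L) L)) = infiniteIdeles L (xx σ k))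
    (hxσ : ∀ (σ : {v : InfinitePlace (Fp L) // v.IsReal}) (k : Matrix.unitaryGroup (R σ) ℂ × Matrix.unitaryGroup (S σ) ℂ),
      InfinitePlace.Completion.extensionEmbedding (cmPlaceOver L σ).1 ((xx σ k : InfiniteAdeleRing L) (cmPlaceOver L σ).1) =
        (k.1 : Matrix (R σ) (R σ) ℂ).det * (k.2 : Matrix (S σ) (S σ) ℂ).det)
    (hx : ∀ (σ : {v : InfinitePlace (Fp L) // v.IsReal}) (k : Matrix.unitaryGroup (R σ) ℂ × Matrix.unitaryGroup (S σ) ℂ) (w : InfinitePlace L), w ≠ (cmPlaceOver L σ).1 →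
      InfinitePlace.Completion.extensionEmbedding w ((xx σ k : InfiniteAdeleRing L) w) = 1)
    -- (DX⁺) (DX⁻) the two derivative letters per place BY VALUE (`Good`-free): the boost `hypOpGen_{pq}` (resp. its `μ₀(D_{π∕2})`-conjugate) of the `σ`-slot
    -- is the arch Lie derivative of the twisted generator family along some `X ∈ 𝔲` (★ W4 + ★ F2 + ★ (T2-an) + ★ FILE 1; payer named by LEAD)
    (hDXp : ∀ (σ : {v : InfinitePlace (Fp L) // v.IsReal}) (rest : ((τ : {v : InfinitePlace (Fp L) // v.IsReal}) → MvPolynomial (DPIdx (Fin 2) (Fin 2) (R τ) (S τ)) ℂ)) (i : Fin 2 × Fin 2) (F : MvPolynomial (DPIdx (Fin 2) (Fin 2) (R σ) (S σ)) ℂ) (f : FinSB (Fp L) (Fin (n' + n'))),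
      ∃ (X : Matrix (Fin (n + n)) (Fin (n + n)) (mixedSpace L)) (hX : X ∈ archSkew (Fp L) L (IsCMField.complexConj L) (n + n) (hermD L e dV hdV dW hdW))
        (c : ℂ) (G : MvPolynomial (DPIdx (Fin 2) (Fin 2) (R σ) (S σ)) ℂ), binvPi G = hypOpGenC (R σ) (S σ) i.1 i.2 (binvPi F) ∧
        HasArchDeriv L e dV hdV dW hdW hX (fun h => genFamily L e dV hdV hdV0 dW hdW hdW0 eW e' dV' hdV' hdV'0 χb hχbu hχbs α 𝒦 (piSchwartzBruhatEquiv (Fp L) (Fin (n' + n')) (tupleVec L dV hdV hdV0 dW hdW hdW0 eW e' dV' hdV' hdV'0 R S eP eQ (Function.update rest σ F) ⊗ₜ[ℂ] f)) ((((3 : ℕ) : ℂ) - (n : ℂ)) / 2) h)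
          (fun h => genFamily L e dV hdV hdV0 dW hdW hdW0 eW e' dV' hdV' hdV'0 χb hχbu hχbs α 𝒦 (piSchwartzBruhatEquiv (Fp L) (Fin (n' + n')) (tupleVec L dV hdV hdV0 dW hdW hdW0 eW e' dV' hdV' hdV'0 R S eP eQ (Function.update rest σ (c • F + G)) ⊗ₜ[ℂ] f)) ((((3 : ℕ) : ℂ) - (n : ℂ)) / 2) h))
    (hDXm : ∀ (σ : {v : InfinitePlace (Fp L) // v.IsReal}) (rest : ((τ : {v : InfinitePlace (Fp L) // v.IsReal}) → MvPolynomial (DPIdx (Fin 2) (Fin 2) (R τ) (S τ)) ℂ)) (i : Fin 2 × Fin 2) (F : MvPolynomial (DPIdx (Fin 2) (Fin 2) (R σ) (S σ)) ℂ) (f : FinSB (Fp L) (Fin (n' + n'))),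
      ∃ (X : Matrix (Fin (n + n)) (Fin (n + n)) (mixedSpace L)) (hX : X ∈ archSkew (Fp L) L (IsCMField.complexConj L) (n + n) (hermD L e dV hdV dW hdW))
        (c : ℂ) (G : MvPolynomial (DPIdx (Fin 2) (Fin 2) (R σ) (S σ)) ℂ),
        binvPi G = unitaryOpPi (phaseU (R σ) (S σ) i.1 (π / 2)) (hypOpGenC (R σ) (S σ) i.1 i.2 (unitaryOpPi (phaseU (R σ) (S σ) i.1 (π / 2))⁻¹ (binvPi F))) ∧
        HasArchDeriv L e dV hdV dW hdW hX (fun h => genFamily L e dV hdV hdV0 dW hdW hdW0 eW e' dV' hdV' hdV'0 χb hχbu hχbs α 𝒦 (piSchwartzBruhatEquiv (Fp L) (Fin (n' + n')) (tupleVec L dV hdV hdV0 dW hdW hdW0 eW e' dV' hdV' hdV'0 R S eP eQ (Function.update rest σ F) ⊗ₜ[ℂ] f)) ((((3 : ℕ) : ℂ) - (n : ℂ)) / 2) h)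
          (fun h => genFamily L e dV hdV hdV0 dW hdW hdW0 eW e' dV' hdV' hdV'0 χb hχbu hχbs α 𝒦 (piSchwartzBruhatEquiv (Fp L) (Fin (n' + n')) (tupleVec L dV hdV hdV0 dW hdW hdW0 eW e' dV' hdV' hdV'0 R S eP eQ (Function.update rest σ (c • F + G)) ⊗ₜ[ℂ] f)) ((((3 : ℕ) : ℂ) - (n : ℂ)) / 2) h)) :
    ∀ (a : ((σ : {v : InfinitePlace (Fp L) // v.IsReal}) → MvPolynomial (DPIdx (Fin 2) (Fin 2) (R σ) (S σ)) ℂ)) (f : FinSB (Fp L) (Fin (n' + n'))) (V' : Submodule ℂ 𝓢(((Fin (n' + n')) → mixedSpace (Fp L)), ℂ)), FiniteDimensional ℂ V' →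
      IsArchStable L e dV hdV hdV0 dW hdW hdW0 eW e' dV' hdV' hdV'0 χb hχbu hχbs 𝒦 V' →
      ∀ hx : piSchwartzBruhatEquiv (Fp L) (Fin (n' + n')) (tupleVec L dV hdV hdV0 dW hdW hdW0 eW e' dV' hdV' hdV'0 R S eP eQ a ⊗ₜ[ℂ] f) ∈ Submodule.span ℂ {x : piSchwartzBruhat (Fp L) (Fin (n' + n')) |
          ∃ a ∈ V', ∃ f : FinSB (Fp L) (Fin (n' + n')), x = piSchwartzBruhatEquiv (Fp L) (Fin (n' + n')) (a ⊗ₜ[ℂ] f)},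
        Good V' ⟨piSchwartzBruhatEquiv (Fp L) (Fin (n' + n')) (tupleVec L dV hdV hdV0 dW hdW hdW0 eW e' dV' hdV' hdV'0 R S eP eQ a ⊗ₜ[ℂ] f), hx⟩ :=
  good_tupleVec_of_rightLegLetters L e dV hdV hdV0 dW hdW hdW0 eW e' dV' hdV' hdV'0 χb hχbu hχbs α 𝒦 R S eP eQ Good hcongr hzero hadd hsmul hderiv
    (K2LiuArchSWDataDomainLetters.hdom_of_hermiteData L e dV hdV hdV0 dW hdW hdW0 eW e' dV' hdV' hdV'0 χb hχbu hχbs 𝒦 R S eP eQ hdat)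
    ht hodd kk hkk xx hdet hxσ hx hDXp hDXm
    (vac_good_of_base L e dV hdV hdV0 dW hdW hdW0 eW e' dV' hdV' hdV'0 χb hχbu hχbs α 𝒦 R S eP eQ Good
      (fun V₀ => HLrecOfRecord L dV hdV hdV0 dW hdW hdW0 eW e' dV' hdV' hdV'0 V₀) hbase hcongr
      (K2LiuArchSWDataDomainLetters.hHL_of_hermiteData L e dV hdV hdV0 dW hdW hdW0 eW e' dV' hdV' hdV'0 χb hχbu hχbs 𝒦 R S eP eQ (hdat 0)))


/-! ## §3 The composition of record, ED. 3: (DX⁺)(DX⁻) by ★ `K2LiuArchSWDataDerivLetters` (K2Liu-p05) from the one-place letter `hψ` -/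

set_option maxHeartbeats 4000000 in -- as ED. 1
/-- **B3-b — COMPOSITION OF RECORD, ED. 3.**  ED. 2 `good_tupleVec_of_hermiteData` with the two derivative letters discharged BY NAME: (DX⁺) := ★ K2Liu-p05
`K2LiuArchSWDataDerivLetters.hDXp_of_onePlaceLetter`, (DX⁻) := ★ `hDXm_of_onePlaceLetter`, both from the ONE per-place letter `hψ` (a section `ψ_σ : U(2,2) →* K_∞` through
the junction at `σ`, its curves `archExp = archEmb ∘ ψ_σ ∘ expMem` and the `detChar` derivatives along them; bytes = p05's binder), which ★ p05
`K2LiuArchSWDataOnePlaceLetter.onePlaceLetter_of_junctionFrames hα` discharges at the frames of record (ED. last).  Residual letters BY VALUE (frames still ABSTRACT,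
F4 desk 00:19:48Z): (R-grp) `kk hkk` + (R-det) `xx hdet hxσ hx` per place, `hψ`, `hdat`, `hbase`, `ht hodd`.  Conclusion: ★ FILE 3's letter (gen) at `t := tupleVec`.
[cite: Howe1989, §3] [cite: KudlaRallis1994, §1, §3] [cite: Folland1989, §4.2 (4.24), Prop. (4.39)] [cite: KonnoKonno2007, §3.3, Lemma 5.2] -/
theorem good_tupleVec_of_onePlaceLetter
    (Good : (V : Submodule ℂ 𝓢(((Fin (n' + n')) → mixedSpace (Fp L)), ℂ)) → ↥(Submodule.span ℂ {x : piSchwartzBruhat (Fp L) (Fin (n' + n')) |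
          ∃ a ∈ V, ∃ f : FinSB (Fp L) (Fin (n' + n')), x = piSchwartzBruhatEquiv (Fp L) (Fin (n' + n')) (a ⊗ₜ[ℂ] f)}) → Prop)
    -- (congr) (zero) (add) (smul) (deriv): ★ `hGgen` bytes verbatim
    (hcongr : ∀ (V V' : Submodule ℂ 𝓢(((Fin (n' + n')) → mixedSpace (Fp L)), ℂ)) (x : ↥(Submodule.span ℂ {x : piSchwartzBruhat (Fp L) (Fin (n' + n')) |
          ∃ a ∈ V, ∃ f : FinSB (Fp L) (Fin (n' + n')), x = piSchwartzBruhatEquiv (Fp L) (Fin (n' + n')) (a ⊗ₜ[ℂ] f)})) (x' : ↥(Submodule.span ℂ {x : piSchwartzBruhat (Fp L) (Fin (n' + n')) |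
          ∃ a ∈ V', ∃ f : FinSB (Fp L) (Fin (n' + n')), x = piSchwartzBruhatEquiv (Fp L) (Fin (n' + n')) (a ⊗ₜ[ℂ] f)})),
      genFamily L e dV hdV hdV0 dW hdW hdW0 eW e' dV' hdV' hdV'0 χb hχbu hχbs α 𝒦 (x : piSchwartzBruhat (Fp L) (Fin (n' + n'))) =
        genFamily L e dV hdV hdV0 dW hdW hdW0 eW e' dV' hdV' hdV'0 χb hχbu hχbs α 𝒦 (x' : piSchwartzBruhat (Fp L) (Fin (n' + n'))) → Good V x → Good V' x')
    (hzero : ∀ (V : Submodule ℂ 𝓢(((Fin (n' + n')) → mixedSpace (Fp L)), ℂ)), FiniteDimensional ℂ V → IsArchStable L e dV hdV hdV0 dW hdW hdW0 eW e' dV' hdV' hdV'0 χb hχbu hχbs 𝒦 V → Good V 0)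
    (hadd : ∀ (V : Submodule ℂ 𝓢(((Fin (n' + n')) → mixedSpace (Fp L)), ℂ)), FiniteDimensional ℂ V → IsArchStable L e dV hdV hdV0 dW hdW hdW0 eW e' dV' hdV' hdV'0 χb hχbu hχbs 𝒦 V →
      ∀ x y : ↥(Submodule.span ℂ {x : piSchwartzBruhat (Fp L) (Fin (n' + n')) |
          ∃ a ∈ V, ∃ f : FinSB (Fp L) (Fin (n' + n')), x = piSchwartzBruhatEquiv (Fp L) (Fin (n' + n')) (a ⊗ₜ[ℂ] f)}), Good V x → Good V y → Good V (x + y))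
    (hsmul : ∀ (V : Submodule ℂ 𝓢(((Fin (n' + n')) → mixedSpace (Fp L)), ℂ)), FiniteDimensional ℂ V → IsArchStable L e dV hdV hdV0 dW hdW hdW0 eW e' dV' hdV' hdV'0 χb hχbu hχbs 𝒦 V →
      ∀ (c : ℂ) (x : ↥(Submodule.span ℂ {x : piSchwartzBruhat (Fp L) (Fin (n' + n')) |
          ∃ a ∈ V, ∃ f : FinSB (Fp L) (Fin (n' + n')), x = piSchwartzBruhatEquiv (Fp L) (Fin (n' + n')) (a ⊗ₜ[ℂ] f)})), Good V x → Good V (c • x))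
    (hderiv : ∀ (V : Submodule ℂ 𝓢(((Fin (n' + n')) → mixedSpace (Fp L)), ℂ)), FiniteDimensional ℂ V → IsArchStable L e dV hdV hdV0 dW hdW hdW0 eW e' dV' hdV' hdV'0 χb hχbu hχbs 𝒦 V →
          ∀ x : ↥(Submodule.span ℂ {x : piSchwartzBruhat (Fp L) (Fin (n' + n')) |
          ∃ a ∈ V, ∃ f : FinSB (Fp L) (Fin (n' + n')), x = piSchwartzBruhatEquiv (Fp L) (Fin (n' + n')) (a ⊗ₜ[ℂ] f)}), Good V x →
          ∀ (X : Matrix (Fin (n + n)) (Fin (n + n)) (mixedSpace L)) (hX : X ∈ archSkew (Fp L) L (IsCMField.complexConj L) (n + n) (hermD L e dV hdV dW hdW))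
            (V' : Submodule ℂ 𝓢(((Fin (n' + n')) → mixedSpace (Fp L)), ℂ)), FiniteDimensional ℂ V' → IsArchStable L e dV hdV hdV0 dW hdW hdW0 eW e' dV' hdV' hdV'0 χb hχbu hχbs 𝒦 V' →
          ∀ x' : ↥(Submodule.span ℂ {x : piSchwartzBruhat (Fp L) (Fin (n' + n')) |
          ∃ a ∈ V', ∃ f : FinSB (Fp L) (Fin (n' + n')), x = piSchwartzBruhatEquiv (Fp L) (Fin (n' + n')) (a ⊗ₜ[ℂ] f)}),
          HasArchDeriv L e dV hdV dW hdW hX (fun h => genFamily L e dV hdV hdV0 dW hdW hdW0 eW e' dV' hdV' hdV'0 χb hχbu hχbs α 𝒦 (x : piSchwartzBruhat (Fp L) (Fin (n' + n'))) ((((3 : ℕ) : ℂ) - (n : ℂ)) / 2) h)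
            (fun h => genFamily L e dV hdV hdV0 dW hdW hdW0 eW e' dV' hdV' hdV'0 χb hχbu hχbs α 𝒦 (x' : piSchwartzBruhat (Fp L) (Fin (n' + n'))) ((((3 : ℕ) : ℂ) - (n : ℂ)) / 2) h) → Good V' x')
    -- (base) of ★ `hGgen` at the hol cut of record `HL₀ := HLrecOfRecord …` (★ LH7-p05; `= holCutOfRecord …`, «`V₀ = ℂ ∙ v_G`»), bytes of ★ `faceG_of_organs` :194–196
    (hbase : ∀ (V₀ : Submodule ℂ 𝓢(((Fin (n' + n')) → mixedSpace (Fp L)), ℂ)), FiniteDimensional ℂ V₀ → IsArchStable L e dV hdV hdV0 dW hdW hdW0 eW e' dV' hdV' hdV'0 χb hχbu hχbs 𝒦 V₀ →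
      HLrecOfRecord L dV hdV hdV0 dW hdW hdW0 eW e' dV' hdV' hdV'0 V₀ → ∀ x₀ : ↥(Submodule.span ℂ {x : piSchwartzBruhat (Fp L) (Fin (n' + n')) |
          ∃ a ∈ V₀, ∃ f : FinSB (Fp L) (Fin (n' + n')), x = piSchwartzBruhatEquiv (Fp L) (Fin (n' + n')) (a ⊗ₜ[ℂ] f)}), Good V₀ x₀)
    -- (dat) the Hermite data BY VALUE: every Hermite span `V_D` of the doubled frame is an arch datum for `𝒦` (★ σ15 `isArchDatum_hermiteSpan … 𝒦 hK D`; K2E3-p31's ★ bytes)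
    (hdat : ∀ D : ℕ, IsArchDatum L e dV hdV dW hdW eW e' dV' hdV'
      (doubledWeilRep L e' dV hdV hdV0 (tensorFrame L dW eW dV') (tensorFrame_real L dW hdW eW dV' hdV') (tensorFrame_ne_zero L dW eW dV' hdW0 hdV'0) χb hχbu hχbs) 𝒦
      (Submodule.span ℂ {x : 𝓢((Fin (n' + n') → mixedSpace (Fp L)), ℂ) | ∃ γ : (Fin (n' + n') × {v : InfinitePlace (Fp L) // v.IsReal}) →₀ ℕ, γ.degree ≤ D ∧
        follandHermite (GRConstruction.frameD L e' dV hdV hdV0 (tensorFrame L dW eW dV') (tensorFrame_real L dW hdW eW dV' hdV') (tensorFrame_ne_zero L dW eW dV' hdW0 hdV'0)) γ = x}))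
    -- the arch type of `χb` (odd unitary type `(t, 0)`, as ★ (P-arch) ∕ ★ p863344)
    {t : InfinitePlace L → ℤ} (ht : χb.HasUnitaryArchType t 0) (hodd : ∀ w, Odd (t w))
    -- (R-grp) + (R-det) BY VALUE per real place (★ p863344's binders `kk hkk xx hdet hxσ hx` at `P = Q = Fin 2`, `R S := R σ, S σ`): (R-grp)(iii) K2E3-p25, (R-det) K2Liu-p26 📤 p863469
    (kk : ∀ σ : {v : InfinitePlace (Fp L) // v.IsReal}, Matrix.unitaryGroup (R σ) ℂ × Matrix.unitaryGroup (S σ) ℂ → UnitaryGroup.adelic (Fp L) L (IsCMField.complexConj L) 3 (Matrix.diagonal dV'))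
    (hkk : ∀ (σ : {v : InfinitePlace (Fp L) // v.IsReal}) (k : Matrix.unitaryGroup (R σ) ℂ × Matrix.unitaryGroup (S σ) ℂ),
      partnerEmb L e dV hdV dW hdW eW e' dV' hdV' (kk σ k) =
        K2LiuArchOneParameterOrbitDefs.archEmb (Fp L) L (IsCMField.complexConj L) (n' + n')
              (hermD L e' dV hdV (tensorFrame L dW eW dV') (tensorFrame_real L dW hdW eW dV' hdV'))
              (placeSecJ L (IsCMField.complexConj L) (n' + n') (IsCMField.complexConj_ne_one L) (cmPlaceOver L) (cmPlaceOver_smul L) _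
                (gramD_gram_realDiagonal_entry_ne_zero L e' dV hdV (tensorFrame L dW eW dV') (tensorFrame_real L dW hdW eW dV' hdV') hdV0 (tensorFrame_ne_zero L dW eW dV' hdW0 hdV'0)) (complexConj_imagUnit L) (imagUnit_ne_zero L) σ
                (cmPlaceOver_comap L) (gramD_eq_diagonal_cm L e' dV hdV (tensorFrame L dW eW dV') (tensorFrame_real L dW hdW eW dV' hdV')) (J := hermD L e' dV hdV (tensorFrame L dW eW dV') (tensorFrame_real L dW hdW eW dV' hdV')) rfl
                (complexConj_smul_infinitePlace L) (eP σ) (eQ σ) ((toBig (Fin 2) (Fin 2) (R σ) (S σ) (κ (Fin 2) (Fin 2) (R σ) (S σ) ((1 : Matrix.unitaryGroup (Fin 2) ℂ × Matrix.unitaryGroup (Fin 2) ℂ), k)), (1 : UForm Unit Empty)) : Ginf ((Fin 2 × R σ) ⊕ (Fin 2 × S σ)) ((Fin 2 × S σ) ⊕ (Fin 2 × R σ)) Unit Empty)))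
    (xx : ∀ σ : {v : InfinitePlace (Fp L) // v.IsReal}, Matrix.unitaryGroup (R σ) ℂ × Matrix.unitaryGroup (S σ) ℂ → (InfiniteAdeleRing L)ˣ)
    (hdet : ∀ (σ : {v : InfinitePlace (Fp L) // v.IsReal}) (k : Matrix.unitaryGroup (R σ) ℂ × Matrix.unitaryGroup (S σ) ℂ),
      Matrix.GeneralLinearGroup.det ((kk σ k : UnitaryGroup.adelic (Fp L) L (IsCMField.complexConj L) 3 (Matrix.diagonal dV')) :
        GL (Fin 3) (AdeleRing (𝓞 L) L)) = infiniteIdeles L (xx σ k))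
    (hxσ : ∀ (σ : {v : InfinitePlace (Fp L) // v.IsReal}) (k : Matrix.unitaryGroup (R σ) ℂ × Matrix.unitaryGroup (S σ) ℂ),
      InfinitePlace.Completion.extensionEmbedding (cmPlaceOver L σ).1 ((xx σ k : InfiniteAdeleRing L) (cmPlaceOver L σ).1) =
        (k.1 : Matrix (R σ) (R σ) ℂ).det * (k.2 : Matrix (S σ) (S σ) ℂ).det)
    (hx : ∀ (σ : {v : InfinitePlace (Fp L) // v.IsReal}) (k : Matrix.unitaryGroup (R σ) ℂ × Matrix.unitaryGroup (S σ) ℂ) (w : InfinitePlace L), w ≠ (cmPlaceOver L σ).1 →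
      InfinitePlace.Completion.extensionEmbedding w ((xx σ k : InfiniteAdeleRing L) w) = 1)
    -- (ψ) THE ONE-PLACE LETTER per real place BY VALUE (★ K2Liu-p05 `K2LiuArchSWDataDerivLetters` binder `hψ` bytes): a section `ψ_σ : U(2,2) →* K_∞` through the junction
    -- at `σ` with its one-parameter curves and `detChar` derivatives — ★ `K2LiuArchSWDataOnePlaceLetter.onePlaceLetter_of_junctionFrames hα …` at the frames of record
    (hψ : letI : LieRing (Matrix (Fin 2 ⊕ Fin 2) (Fin 2 ⊕ Fin 2) ℂ) := LieRing.ofAssociativeRing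
      ∀ σ : {v : InfinitePlace (Fp L) // v.IsReal}, ∃ ψ : UForm (Fin 2) (Fin 2) →* UnitaryGroup.arch (Fp L) L (IsCMField.complexConj L) (n + n) (hermD L e dV hdV dW hdW),
      (∀ h : UForm (Fin 2) (Fin 2),
        tensorEmb L e dV hdV dW hdW eW e' dV' hdV' (K2LiuArchOneParameterOrbitDefs.archEmb (Fp L) L (IsCMField.complexConj L) (n + n) (hermD L e dV hdV dW hdW) (ψ h)) =
          K2LiuArchOneParameterOrbitDefs.archEmb (Fp L) L (IsCMField.complexConj L) (n' + n') (hermD L e' dV hdV (tensorFrame L dW eW dV') (tensorFrame_real L dW hdW eW dV' hdV'))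
            (placeSecJ L (IsCMField.complexConj L) (n' + n') (IsCMField.complexConj_ne_one L) (cmPlaceOver L) (cmPlaceOver_smul L) _ (gramD_gram_realDiagonal_entry_ne_zero L e' dV hdV (tensorFrame L dW eW dV') (tensorFrame_real L dW hdW eW dV' hdV') hdV0 (tensorFrame_ne_zero L dW eW dV' hdW0 hdV'0)) (complexConj_imagUnit L)
            (imagUnit_ne_zero L) σ (cmPlaceOver_comap L) (gramD_eq_diagonal_cm L e' dV hdV (tensorFrame L dW eW dV') (tensorFrame_real L dW hdW eW dV' hdV')) (J := hermD L e' dV hdV (tensorFrame L dW eW dV') (tensorFrame_real L dW hdW eW dV' hdV')) rfl (complexConj_smul_infinitePlace L) (eP σ) (eQ σ) ((toBig (Fin 2) (Fin 2) (R σ) (S σ) (h, 1), (1 : UForm Unit Empty)) : Ginf ((Fin 2 × R σ) ⊕ (Fin 2 × S σ)) ((Fin 2 × S σ) ⊕ (Fin 2 × R σ)) Unit Empty))) ∧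
      ∀ Y : ↥(uFormGroup (Fin 2) (Fin 2)).lie.toSubmodule, ∃ (X : Matrix (Fin (n + n)) (Fin (n + n)) (mixedSpace L)) (hX : X ∈ archSkew (Fp L) L (IsCMField.complexConj L) (n + n) (hermD L e dV hdV dW hdW)) (c : ℂ),
        (∀ s : ℝ, K2LiuArchOneParameterOrbitDefs.archExp (Fp L) L (IsCMField.complexConj L) (n + n) (hermD L e dV hdV dW hdW) hX s = K2LiuArchOneParameterOrbitDefs.archEmb (Fp L) L (IsCMField.complexConj L) (n + n) (hermD L e dV hdV dW hdW) (ψ ((uFormGroup (Fin 2) (Fin 2)).expMem ⟨((s • Y : ↥(uFormGroup (Fin 2) (Fin 2)).lie.toSubmodule) : Matrix (Fin 2 ⊕ Fin 2) (Fin 2 ⊕ Fin 2) ℂ), (s • Y).2⟩ : UForm (Fin 2) (Fin 2)))) ∧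
        HasDerivAt (fun t' : ℝ => ((((DoubledWeilDetTwist.detChar L e dV hdV hdV0 dW hdW hdW0 α) (K2LiuArchOneParameterOrbitDefs.archExp (Fp L) L (IsCMField.complexConj L) (n + n) (hermD L e dV hdV dW hdW) hX t')) : ℂˣ) : ℂ)) c 0) :
    ∀ (a : ((σ : {v : InfinitePlace (Fp L) // v.IsReal}) → MvPolynomial (DPIdx (Fin 2) (Fin 2) (R σ) (S σ)) ℂ)) (f : FinSB (Fp L) (Fin (n' + n'))) (V' : Submodule ℂ 𝓢(((Fin (n' + n')) → mixedSpace (Fp L)), ℂ)), FiniteDimensional ℂ V' →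
      IsArchStable L e dV hdV hdV0 dW hdW hdW0 eW e' dV' hdV' hdV'0 χb hχbu hχbs 𝒦 V' →
      ∀ hx : piSchwartzBruhatEquiv (Fp L) (Fin (n' + n')) (tupleVec L dV hdV hdV0 dW hdW hdW0 eW e' dV' hdV' hdV'0 R S eP eQ a ⊗ₜ[ℂ] f) ∈ Submodule.span ℂ {x : piSchwartzBruhat (Fp L) (Fin (n' + n')) |
          ∃ a ∈ V', ∃ f : FinSB (Fp L) (Fin (n' + n')), x = piSchwartzBruhatEquiv (Fp L) (Fin (n' + n')) (a ⊗ₜ[ℂ] f)},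
        Good V' ⟨piSchwartzBruhatEquiv (Fp L) (Fin (n' + n')) (tupleVec L dV hdV hdV0 dW hdW hdW0 eW e' dV' hdV' hdV'0 R S eP eQ a ⊗ₜ[ℂ] f), hx⟩ :=
  good_tupleVec_of_hermiteData L e dV hdV hdV0 dW hdW hdW0 eW e' dV' hdV' hdV'0 χb hχbu hχbs α 𝒦 R S eP eQ Good hcongr hzero hadd hsmul hderiv hbase hdat
    ht hodd kk hkk xx hdet hxσ hx
    (K2LiuArchSWDataDerivLetters.hDXp_of_onePlaceLetter L e dV hdV hdV0 dW hdW hdW0 eW e' dV' hdV' hdV'0 χb hχbu hχbs α 𝒦 R S eP eQ ht hodd hψ)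
    (K2LiuArchSWDataDerivLetters.hDXm_of_onePlaceLetter L e dV hdV hdV0 dW hdW hdW0 eW e' dV' hdV' hdV'0 χb hχbu hχbs α 𝒦 R S eP eQ ht hodd hψ)

end Summit.HodgeConjecture.HodgeConjecture.Cruxes.HLiu418.K2LiuArchSWDataInductionFinal

end
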